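import Mathlib
import HarnessLib
import Summits.Ventures.LatticeQCDFlow.Exactness.IMHKernel
import Summits.Ventures.LatticeQCDFlow.Exactness.IMHNaiveRetryBias

/-!
# LatticeQCDFlow / Exactness — FALLING BACK TO ANOTHER EXACT UPDATE ONLY WHEN THE FLOW PROPOSAL IS REJECTED IS NOT EXACT:
# the rejection-triggered hybrid samples the wrong law (defect identity on a general state space + a two-point witness);
# the state-blind schedules (always follow, or mix with a fixed probability) are exact

HONEST FRAMING: exact (Metropolis-corrected) sampling algorithms for lattice gauge theory;
figures of merit are autocorrelation/cost numbers at stated couplings and volumes; no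
continuum-physics claim.

Venture `LatticeQCDFlow` (cell pub-lqcd), topic `Exactness`, FANOUT row 30 (lean-1 GEN-43, theme SECOND CHANCES; the hybrid twin
of `IMHNaiveRetryBias`).  NEW WORK of the cell over `IMHKernel` and `IMHNaiveRetryBias` (`lintegral_min_weight_eq`, the `Bool`
bookkeeping `NaiveRetryWitness.*`); no definition is introduced, nothing is cited as a fact.  Printed counterparts, NAMED ONLY: the
general principle that a STATE-DEPENDENT choice among exact kernels is not exact (Roberts–Rosenthal, J. Appl. Probab. 44 (2007);
the tree's finite caricature `Exactness/OnlineAdaptation`), and the exact remedies: composition and state-blind mixtures of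
exact kernels (Tierney 1994 §2.4), delayed rejection with the Tierney–Mira price (`IMHDelayedRejectionExact`).

## The rejection-triggered hybrid (general measurable `Ω`; flow law `q`; weight `w > 0`; `a`, `A`, `π = w·q` as in `IMHKernel`;
## `L` = ANY Markov kernel leaving `π` invariant — a heat-bath sweep, an HMC trajectory, another flow's exact step)

From `x`: draw `y ∼ q` and accept with `a(x, y)`; IF REJECTED, make one `L`-move from `x` instead of staying.  Def-free: ANY kernel
`K` with `K(x, B) = ∫_B a(x, y) q(dy) + (1 − A(x))·L(x, B)` (hypothesis `hK`).  Each ingredient is exact; the schedule reads the chain.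

## Results [all ours]

* `fallback_apply_univ` ∕ `fallback_isMarkovKernel`.
* **`fallback_bind_apply_add` (THE DEFECT IDENTITY)**: with the REJECTION-WEIGHTED measure `ρ = (1 − A)·π`,
  `(πK)(B) + ρ(B) = π(B) + (ρL)(B)` for every measurable `B` — the hybrid is exact iff the fallback kernel preserves `ρ`, NOT `π`.
  A `π`-exact `L` moves `ρ`-mass from where rejections are frequent (heavy configurations, `A` small) to where they are rare: the
  hybrid OVER-SAMPLES THE LIGHT, FLOW-LIKE CONFIGURATIONS, like the naive retry.
* `fallback_bind_apply_eq_of_acceptMass_const`: sharp — a constant acceptance mass (`ρ = (1 − c)π`) makes the hybrid exact.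
* **THE EXACT SCHEDULES**: `imh_comp_invariant` — ALWAYS following the flow step by the `L`-move (`L ∘ₖ indepMH q w`) is exact
  (Mathlib's `Kernel.Invariant.comp`); so is `L` first (`indepMH_comp_invariant`).  (State-blind mixtures: the tree's `KernelMixture`.)
* **`fallback_not_invariant` (WITNESS)**: `Ω = Bool`, `q` uniform, `w = (1, 2)`, `L` = an independent redraw from the normalised target
  `π̄ = (1/3, 2/3)` — itself exact (`NaiveRetryWitness.redraw_invariant`): EVERY kernel realising the hybrid moves `π({false}) = 1/2` to
  `7/12` in one step (`fallback_bind_apply_false`).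

Not here: the stationary law of the hybrid; fallbacks triggered by other chain-read events (same mechanism); the cure with a priced
second stage for a general `L` (needs densities — Tierney–Mira with `L`'s density against a reference measure).
-/

namespace Summit.Ventures.LatticeQCDFlow.Exactness

open MeasureTheory ProbabilityTheory
open scoped ENNReal

variable {Ω : Type*} [MeasurableSpace Ω] {q : Measure Ω} [IsProbabilityMeasure q] {w : Ω → ℝ}

/-! ## §1 The hybrid is a Markov kernel -/

/-- `K(x, Ω) = A(x) + (1 − A(x))·1 = 1`. [ours] -/
theorem fallback_apply_univ (L : Kernel Ω Ω) [IsMarkovKernel L] (K : Kernel Ω Ω)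
    (hK : ∀ (x : Ω) {B : Set Ω}, MeasurableSet B → K x B =
      ∫⁻ y in B, imhAcceptE w x y ∂q + (1 - imhAcceptMass q w x) * L x B)
    (x : Ω) : K x Set.univ = 1 := by
  rw [hK x MeasurableSet.univ, Measure.restrict_univ, measure_univ, mul_one,
    show ∫⁻ y, imhAcceptE w x y ∂q = imhAcceptMass q w x from rfl, add_tsub_cancel_of_le (imhAcceptMass_le_one q w x)]

/-- Hence `K` is a Markov kernel. [ours, bookkeeping] -/
theorem fallback_isMarkovKernel (L : Kernel Ω Ω) [IsMarkovKernel L] (K : Kernel Ω Ω)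
    (hK : ∀ (x : Ω) {B : Set Ω}, MeasurableSet B → K x B =
      ∫⁻ y in B, imhAcceptE w x y ∂q + (1 - imhAcceptMass q w x) * L x B) :
    IsMarkovKernel K :=
  ⟨fun x => ⟨fallback_apply_univ L K hK x⟩⟩

/-! ## §2 The defect identity -/

/-- **`(πK)(B)` SPLIT BY THE TWO BRANCHES**: `(πK)(B) = ∫_B w(y)A(y) q(dy) + ∫ w(x)(1 − A(x))·L(x, B) q(dx)`. [ours] -/
theorem fallback_bind_apply (hw : Measurable w) (hw0 : ∀ x, 0 < w x) (L : Kernel Ω Ω) (K : Kernel Ω Ω)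
    (hK : ∀ (x : Ω) {B : Set Ω}, MeasurableSet B → K x B =
      ∫⁻ y in B, imhAcceptE w x y ∂q + (1 - imhAcceptMass q w x) * L x B)
    {B : Set Ω} (hB : MeasurableSet B) :
    ((q.withDensity fun y => ENNReal.ofReal (w y)).bind K) B =
      ∫⁻ y in B, ENNReal.ofReal (w y) * imhAcceptMass q w y ∂q +
        ∫⁻ x, ENNReal.ofReal (w x) * ((1 - imhAcceptMass q w x) * L x B) ∂q := by
  have hd : Measurable fun x => ENNReal.ofReal (w x) := hw.ennreal_ofReal
  have ha : Measurable (Function.uncurry (imhAcceptE w)) := measurable_imhAcceptE hw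
  have hI : Measurable fun x => ∫⁻ y in B, imhAcceptE w x y ∂q := by
    have : Measurable fun x => ∫⁻ y, B.indicator (fun y => imhAcceptE w x y) y ∂q :=
      (Measurable.indicator ha (measurable_snd hB) :
        Measurable fun p : Ω × Ω => B.indicator (fun y => imhAcceptE w p.1 y) p.2).lintegral_prod_right'
    simpa only [lintegral_indicator hB] using this
  have hmin : Measurable (Function.uncurry fun x y : Ω => ENNReal.ofReal (min (w x) (w y))) :=
    ((hw.comp measurable_fst).min (hw.comp measurable_snd)).ennreal_ofReal
  rw [Measure.bind_apply hB (Kernel.aemeasurable _), lintegral_withDensity_eq_lintegral_mul _ hd (Kernel.measurable_coe K hB)]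
  simp only [Pi.mul_apply]
  simp_rw [hK _ hB, mul_add]
  have h1m : Measurable fun x => ENNReal.ofReal (w x) * ∫⁻ y in B, imhAcceptE w x y ∂q := hd.mul hI
  rw [lintegral_add_left h1m]
  congr 1
  have hflux : ∀ x, ENNReal.ofReal (w x) * ∫⁻ y in B, imhAcceptE w x y ∂q = ∫⁻ y in B, ENNReal.ofReal (min (w x) (w y)) ∂q := by
    intro x
    rw [← lintegral_const_mul _ (ha.of_uncurry_left)]
    exact lintegral_congr fun y => ofReal_mul_imhAcceptE hw0 x y
  simp_rw [hflux]
  rw [lintegral_lintegral_swap (hmin.aemeasurable (μ := q.prod (q.restrict B)))]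
  exact lintegral_congr fun y => lintegral_min_weight_eq hw hw0 y

/-- **THE DEFECT IDENTITY OF THE REJECTION-TRIGGERED HYBRID.**  With `ρ = (1 − A)·π` the rejection-weighted measure,
`(πK)(B) + ρ(B) = π(B) + (ρL)(B)`: the hybrid is exact iff the fallback kernel leaves `ρ` — not `π` — invariant. [ours] -/
theorem fallback_bind_apply_add (hw : Measurable w) (hw0 : ∀ x, 0 < w x) (L : Kernel Ω Ω) (K : Kernel Ω Ω)
    (hK : ∀ (x : Ω) {B : Set Ω}, MeasurableSet B → K x B =
      ∫⁻ y in B, imhAcceptE w x y ∂q + (1 - imhAcceptMass q w x) * L x B)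
    {B : Set Ω} (hB : MeasurableSet B) :
    ((q.withDensity fun y => ENNReal.ofReal (w y)).bind K) B +
        (q.withDensity fun y => ENNReal.ofReal (w y) * (1 - imhAcceptMass q w y)) B =
      (q.withDensity fun y => ENNReal.ofReal (w y)) B +
        ((q.withDensity fun y => ENNReal.ofReal (w y) * (1 - imhAcceptMass q w y)).bind L) B := by
  have hd : Measurable fun x => ENNReal.ofReal (w x) := hw.ennreal_ofReal
  have hR : Measurable fun x => 1 - imhAcceptMass q w x := measurable_const.sub (measurable_imhAcceptMass q hw)
  have hA : Measurable fun y => ENNReal.ofReal (w y) * imhAcceptMass q w y := hd.mul (measurable_imhAcceptMass q hw)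
  have hdR : Measurable fun y => ENNReal.ofReal (w y) * (1 - imhAcceptMass q w y) := hd.mul hR
  rw [fallback_bind_apply hw hw0 L K hK hB, withDensity_apply _ hB, withDensity_apply _ hB,
    Measure.bind_apply hB (Kernel.aemeasurable _), lintegral_withDensity_eq_lintegral_mul _ hdR (Kernel.measurable_coe L hB)]
  simp only [Pi.mul_apply]
  rw [add_assoc, add_comm (∫⁻ x, ENNReal.ofReal (w x) * ((1 - imhAcceptMass q w x) * L x B) ∂q), ← add_assoc,
    ← lintegral_add_left hA]
  simp_rw [← mul_assoc]
  congr 1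
  refine lintegral_congr fun y => ?_
  rw [← mul_add, add_tsub_cancel_of_le (imhAcceptMass_le_one q w y), mul_one]

/-- **SHARPNESS**: a CONSTANT acceptance mass (`ρ = (1 − c)·π`) makes the rejection-triggered hybrid exact (finite-flux sets). [ours] -/
theorem fallback_bind_apply_eq_of_acceptMass_const (hw : Measurable w) (hw0 : ∀ x, 0 < w x) (L : Kernel Ω Ω)
    (hL : Kernel.Invariant L (q.withDensity fun y => ENNReal.ofReal (w y))) (K : Kernel Ω Ω)
    (hK : ∀ (x : Ω) {B : Set Ω}, MeasurableSet B → K x B =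
      ∫⁻ y in B, imhAcceptE w x y ∂q + (1 - imhAcceptMass q w x) * L x B)
    {c : ℝ≥0∞} (hc : ∀ x, imhAcceptMass q w x = c) {B : Set Ω} (hB : MeasurableSet B)
    (hfin : (q.withDensity fun y => ENNReal.ofReal (w y)) B ≠ ⊤) :
    ((q.withDensity fun y => ENNReal.ofReal (w y)).bind K) B = (q.withDensity fun y => ENNReal.ofReal (w y)) B := by
  have h := fallback_bind_apply_add hw hw0 L K hK hB
  have hρ : (q.withDensity fun y => ENNReal.ofReal (w y) * (1 - imhAcceptMass q w y)) =
      (1 - c) • q.withDensity fun y => ENNReal.ofReal (w y) := by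
    rw [show (fun y => ENNReal.ofReal (w y) * (1 - imhAcceptMass q w y)) = (1 - c) • (fun y => ENNReal.ofReal (w y)) from
      funext fun y => by simp only [Pi.smul_apply, smul_eq_mul, hc, mul_comm]]
    exact withDensity_smul _ hw.ennreal_ofReal
  rw [hρ, Measure.bind_smul, hL.def, Measure.smul_apply, smul_eq_mul] at h
  have hfin' : (1 - c) * (q.withDensity fun y => ENNReal.ofReal (w y)) B ≠ ⊤ :=
    ENNReal.mul_ne_top (ne_top_of_le_ne_top ENNReal.one_ne_top tsub_le_self) hfin
  exact (ENNReal.add_left_inj hfin').1 h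

/-! ## §3 The exact schedules: composition (always follow) -/

/-- **ALWAYS FOLLOWING THE FLOW STEP BY THE EXACT MOVE IS EXACT**: `L ∘ₖ indepMH q w` leaves `π` invariant for every `π`-invariant `L`. [ours] -/
theorem imh_comp_invariant (hw : Measurable w) (hw0 : ∀ x, 0 < w x) (L : Kernel Ω Ω)
    (hL : Kernel.Invariant L (q.withDensity fun y => ENNReal.ofReal (w y))) :
    Kernel.Invariant (L ∘ₖ indepMH q w) (q.withDensity fun y => ENNReal.ofReal (w y)) :=
  hL.comp (indepMH_invariant hw hw0)

/-- … and so is the other order, `indepMH q w ∘ₖ L`. [ours] -/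
theorem indepMH_comp_invariant (hw : Measurable w) (hw0 : ∀ x, 0 < w x) (L : Kernel Ω Ω)
    (hL : Kernel.Invariant L (q.withDensity fun y => ENNReal.ofReal (w y))) :
    Kernel.Invariant (indepMH q w ∘ₖ L) (q.withDensity fun y => ENNReal.ofReal (w y)) :=
  (indepMH_invariant hw hw0).comp hL

/-! ## §4 The two-point witness: an exact fallback, a biased hybrid -/

section FallbackWitness

variable {q : Measure Bool} {w : Bool → ℝ} {ν : Measure Bool}

/-- The fallback of the witness — an independent redraw from the normalised target `π̄ = (1/3, 2/3)` — IS exact for `π = (1/2, 1)`. [ours] -/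
theorem NaiveRetryWitness.redraw_invariant (hq : ∀ b, q {b} = ENNReal.ofReal 2⁻¹) (hwf : w false = 1) (hwt : w true = 2)
    (hνf : ν {false} = ENNReal.ofReal 3⁻¹) (hνt : ν {true} = ENNReal.ofReal (2 / 3)) :
    Kernel.Invariant (Kernel.const Bool ν) (q.withDensity fun y => ENNReal.ofReal (w y)) := by
  obtain ⟨hπf, hπt⟩ := NaiveRetryWitness.target_eq hq hwf hwt
  have huniv : (q.withDensity fun y => ENNReal.ofReal (w y)) Set.univ = ENNReal.ofReal (3 / 2) := by
    rw [show (Set.univ : Set Bool) = {false} ∪ {true} by ext b; cases b <;> simp,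
      measure_union (by simp) (measurableSet_singleton _), hπf, hπt, ← ENNReal.ofReal_one,
      ← ENNReal.ofReal_add (by norm_num) (by norm_num)]
    norm_num
  show (q.withDensity fun y => ENNReal.ofReal (w y)).bind (Kernel.const Bool ν) = _
  refine Measure.ext_of_singleton fun b => ?_
  rw [Measure.bind_apply (measurableSet_singleton b) (Kernel.aemeasurable _)]
  simp only [Kernel.const_apply, lintegral_const, huniv]
  cases b
  · rw [hνf, hπf, ← ENNReal.ofReal_mul (by norm_num)]; norm_num
  · rw [hνt, hπt, ← ENNReal.ofReal_mul (by norm_num), ← ENNReal.ofReal_one]; norm_num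

/-- **THE WITNESS, QUANTIFIED**: one hybrid step from `π` puts mass `7/12` on `false` (target `1/2 = 6/12`). [ours] -/
theorem fallback_bind_apply_false (hq : ∀ b, q {b} = ENNReal.ofReal 2⁻¹) (hwf : w false = 1) (hwt : w true = 2)
    (hνf : ν {false} = ENNReal.ofReal 3⁻¹) (K : Kernel Bool Bool)
    (hK : ∀ (x : Bool) {B : Set Bool}, MeasurableSet B → K x B =
      ∫⁻ y in B, imhAcceptE w x y ∂q + (1 - imhAcceptMass q w x) * (Kernel.const Bool ν) x B) :
    ((q.withDensity fun y => ENNReal.ofReal (w y)).bind K) {false} = ENNReal.ofReal (7 / 12) := by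
  obtain ⟨hff, -, htf, -⟩ := NaiveRetryWitness.imhAcceptE_eq hwf hwt
  obtain ⟨hAf, hAt⟩ := NaiveRetryWitness.imhAcceptMass_eq hq hwf hwt
  obtain ⟨hπf, hπt⟩ := NaiveRetryWitness.target_eq hq hwf hwt
  have hKf : K false {false} = ENNReal.ofReal 2⁻¹ := by
    rw [hK false (measurableSet_singleton _), NaiveRetryWitness.setLIntegral_false_eq hq, hff, hAf, tsub_self, one_mul,
      zero_mul, add_zero]
  have hKt : K true {false} = ENNReal.ofReal (1 / 3) := by
    rw [hK true (measurableSet_singleton _), NaiveRetryWitness.setLIntegral_false_eq hq, htf, hAt, Kernel.const_apply, hνf,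
      ← ENNReal.ofReal_one, ← ENNReal.ofReal_sub _ (by norm_num), ← ENNReal.ofReal_mul (by norm_num),
      ← ENNReal.ofReal_mul (by norm_num), ← ENNReal.ofReal_add (by norm_num) (by norm_num)]
    norm_num
  rw [Measure.bind_apply (measurableSet_singleton _) (Kernel.aemeasurable _), lintegral_fintype, Fintype.sum_bool,
    hKf, hKt, hπf, hπt, mul_one, ← ENNReal.ofReal_mul (by norm_num), ← ENNReal.ofReal_add (by norm_num) (by norm_num)]
  norm_num

/-- **THE REJECTION-TRIGGERED HYBRID IS NOT EXACT**: on the two-point space, with an exact flow step and an exact fallback, for EVERY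
kernel realising "fallback only on rejection", `π` is NOT invariant. [ours] -/
theorem fallback_not_invariant (hq : ∀ b, q {b} = ENNReal.ofReal 2⁻¹) (hwf : w false = 1) (hwt : w true = 2)
    (hνf : ν {false} = ENNReal.ofReal 3⁻¹) (K : Kernel Bool Bool)
    (hK : ∀ (x : Bool) {B : Set Bool}, MeasurableSet B → K x B =
      ∫⁻ y in B, imhAcceptE w x y ∂q + (1 - imhAcceptMass q w x) * (Kernel.const Bool ν) x B) :
    ¬ Kernel.Invariant K (q.withDensity fun y => ENNReal.ofReal (w y)) := by
  intro h
  have h1 := congrArg (fun μ : Measure Bool => μ {false}) h.def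
  rw [fallback_bind_apply_false hq hwf hwt hνf K hK, (NaiveRetryWitness.target_eq hq hwf hwt).1,
    ENNReal.ofReal_eq_ofReal_iff (by norm_num) (by norm_num)] at h1
  norm_num at h1

/-- The normalised target `(1/3, 2/3)` of the witness exists as a probability law on `Bool`. [ours, remark] -/
theorem NaiveRetryWitness.redraw_exists :
    ∃ ν : Measure Bool, IsProbabilityMeasure ν ∧ ν {false} = ENNReal.ofReal 3⁻¹ ∧ ν {true} = ENNReal.ofReal (2 / 3) := by
  refine ⟨ENNReal.ofReal 3⁻¹ • Measure.dirac false + ENNReal.ofReal (2 / 3) • Measure.dirac true, ⟨?_⟩, ?_, ?_⟩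
  · rw [Measure.add_apply, Measure.smul_apply, Measure.smul_apply, measure_univ, measure_univ, smul_eq_mul, smul_eq_mul,
      mul_one, mul_one, ← ENNReal.ofReal_add (by norm_num) (by norm_num)]
    norm_num
  · simp [Measure.dirac_apply']
  · simp [Measure.dirac_apply']

end FallbackWitness

end Summit.Ventures.LatticeQCDFlow.Exactness
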